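import Literature.Computability.AlgebraicComplexity.ApproximativeRootClosure
import Literature.Computability.AlgebraicComplexity.BLMW11KroneckerApproximation
import Literature.Computability.AlgebraicComplexity.DeterminantalIdealComplexityDescent
import HarnessLib

/-!
# Border computations lie in the Zariski closure of the size class (Bürgisser 2004, Thm. 2.2,
# the "easy" inclusion; BLMW 2011, remark after Def. 9.3.1) — PROVED

Topic `Computability/AlgebraicComplexity`. The tree now carries TWO renderings of the approximative
complexity `L̲`: the algebraic `ε`-rendering `borderComplexity` (`ApproximativeRootClosure.lean`:
a circuit over `F((ε))` computing `f + O(ε)`; Bürgisser 2004 Def. 2.1, CKRST 2020 v4 Def. 1.12)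
and the topological rendering `approxComplexity` (`BLMW11KroneckerApproximation.lean`: `coeffVec f`
in the Zariski closure of the coefficient vectors of `{g | L(g) ≤ r}`; BLMW 2011 Def. 9.3.1).
Bürgisser 2004, Thm. 2.2 (after Alder 1984): over an algebraically closed field the set
`{f | L̲(f) ≤ r}` IS the Zariski closure of `{f | L(f) ≤ r}`. This file PROVES the inclusion
Bürgisser calls "easy to see" ("if `L̲(f) ≤ r` then `f` lies in the closure (Zariski or Euclidean)
of the set `{L(f) ≤ r}`"), over every infinite field and in the tree's exact currencies:

* `coeffVec_mem_zariskiClosure_of_polyOrdGE` — if `h ∈ F((ε))[x]` has `L(h) ≤ r` and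
  `h = f + O(ε)`, then `coeffVec f ∈ zariskiClosure (coeffVec '' {g : F[x] | L(g) ≤ r})`
  (`F` infinite);
* `coeffVec_mem_zariskiClosure_of_borderComplexity_le` — the same from `borderComplexity f ≤ r`;
* `approxComplexity_le_borderComplexity` — over `ℂ`: BLMW's `L̲_Zariski(f) ≤ L̲_ε(f)`.

The converse inclusion (Alder; B04 Thm. 5.6 with the order bound `q ≤ 2^{L̲(f)²}` via
Lehmkuhl–Lickteig) is NOT formalised. Honest framing: a 2004 remark re-proved; nothing here
bears on `VP ≠ VNP`, which is NOT proved.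

## Proof ("generic constants", B04 §5.3 / BCS §4.1)

Let `P ∈ F[c_m : m monomial]` vanish on the coefficient vectors of every `g ∈ F[x]` with
`L(g) ≤ r`, and let `C` be a fan-in-two circuit over `K = F((ε))` of size `≤ r` computing `h`.
Replace every constant `γ ∈ K` of `C` by the variable `X_γ` of `A = F[X_γ : γ ∈ K]`
(`ArithCircuit.mapConsts`): the generic circuit `C̃` over `A` computes `H̃ ∈ A[x]`, specialises
back to `C` along `X_γ ↦ γ` (`map_mapConsts_eq_self`, so `h = H̃(γ)`), and specialises along ANY
`a : K → F` to a circuit over `F` of the same size computing `H̃(a) ∈ F[x]`, on whose coefficient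
vector `P` vanishes. Hence the polynomial `Pgen := P(coeff H̃) ∈ A` vanishes at every `F`-point, so
`Pgen = 0` (`F` infinite), so `P(coeff h) = Pgen(γ) = 0` in `K`; and `P(coeff h) = P(coeff f) + O(ε)`
because `P` has coefficients in `F`, whence `P(coeff f) = 0`.

## References

* [Burgisser2004Factors] P. Bürgisser, Found. Comput. Math. 4 (2004) = arXiv:1812.06828, Thm. 2.2
  and the sentence preceding it (corpus `paper:arxiv-1812.06828` p0007 L89–99); §5.3 (generic
  straight-line programs `φ_Γ`, p0015 L1–18).
* [BurgisserEtAl2011] P. Bürgisser, J. M. Landsberg, L. Manivel, J. Weyman, SIAM J. Comput. 40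
  (2011), Def. 9.3.1 and the remark following it (Zariski = Euclidean closure for constructible sets).
-/

noncomputable section

namespace Literature.Computability.AlgebraicComplexity

open MvPolynomial

universe u v

section Generic

variable {F : Type u} [Field F] {σ : Type v}

/-- Evaluating a polynomial with coefficients in `F` at two `F((ε))`-points that are `O(1)` and
agree modulo `ε` gives `O(1)` values that agree modulo `ε`. [folklore] -/
private theorem isOrdGE_aeval_sub_aeval {τ : Type*} (P : MvPolynomial τ F)
    {x y : τ → LaurentSeries F} (hx : ∀ t, IsOrdGE 0 (x t)) (hy : ∀ t, IsOrdGE 0 (y t))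
    (hxy : ∀ t, IsOrdGE 1 (x t - y t)) :
    IsOrdGE 0 (aeval x P) ∧ IsOrdGE 0 (aeval y P) ∧ IsOrdGE 1 (aeval x P - aeval y P) := by
  induction P using MvPolynomial.induction_on with
  | C a =>
    simp only [algHom_C, algebraMap_laurentSeries_apply, sub_self]
    exact ⟨IsOrdGE.C a, IsOrdGE.C a, IsOrdGE.zero 1⟩
  | add p q hp hq =>
    obtain ⟨hp0, hp1, hp2⟩ := hp
    obtain ⟨hq0, hq1, hq2⟩ := hq
    refine ⟨?_, ?_, ?_⟩
    · rw [map_add]; exact hp0.add hq0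
    · rw [map_add]; exact hp1.add hq1
    · have : aeval x (p + q) - aeval y (p + q) = (aeval x p - aeval y p) + (aeval x q - aeval y q) := by
        rw [map_add, map_add]; ring
      rw [this]; exact hp2.add hq2
  | mul_X p t hp =>
    obtain ⟨hp0, hp1, hp2⟩ := hp
    refine ⟨?_, ?_, ?_⟩
    · rw [map_mul, aeval_X]; simpa using hp0.mul (hx t)
    · rw [map_mul, aeval_X]; simpa using hp1.mul (hy t)
    · have : aeval x (p * X t) - aeval y (p * X t) =
          (aeval x p - aeval y p) * x t + aeval y p * (x t - y t) := by
        rw [map_mul, map_mul, aeval_X, aeval_X]; ring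
      rw [this]
      have h1 := hp2.mul (hx t)
      have h2 := hp1.mul (hxy t)
      simp only [add_zero, zero_add] at h1 h2
      exact h1.add h2

variable [Infinite F]

/-- **Bürgisser 2004, Thm. 2.2 (the easy inclusion), in the tree's currencies — PROVED:** if a
polynomial `h ∈ F((ε))[x]` of fan-in-two size `L(h) ≤ r` satisfies `h = f + O(ε)` coefficientwise,
then the coefficient vector of `f ∈ F[x]` lies in the Zariski closure of the coefficient vectors of
the polynomials `g ∈ F[x]` with `L(g) ≤ r` ("if `L̲(f) ≤ r` then it is easy to see that `f` lies in
the closure … of the set `{f ∈ A_n | L(f) ≤ r}`"); `F` infinite (generic-constants argument, see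
the module docstring). [cite: Burgisser2004Factors, Thm. 2.2 (arXiv:1812.06828 §2, sentence preceding the theorem)] -/
theorem coeffVec_mem_zariskiClosure_of_polyOrdGE (f : MvPolynomial σ F)
    (h : MvPolynomial σ (LaurentSeries F)) {r : ℕ} (hr : complexity h ≤ r)
    (hh : PolyOrdGE 1 (h - MvPolynomial.map (algebraMap F (LaurentSeries F)) f)) :
    coeffVec f ∈ zariskiClosure (coeffVec '' {g : MvPolynomial σ F | complexity g ≤ r}) := by
  classical
  rw [mem_zariskiClosure_iff]
  intro P hP
  -- a size-optimal fan-in-two circuit for `h` over `K = F((ε))`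
  obtain ⟨C, hC2, hCh, hCs⟩ := ArithCircuit.exists_computes_size_eq_complexity h
  -- generic constants: `A = F[X_γ : γ ∈ K]`, `ψ : X_γ ↦ γ`
  set ψ : MvPolynomial (LaurentSeries F) F →ₐ[F] LaurentSeries F := aeval id with hψ
  set Ct : ArithCircuit (MvPolynomial (LaurentSeries F) F) σ :=
    C.mapConsts (X : LaurentSeries F → MvPolynomial (LaurentSeries F) F) with hCt
  have hback : Ct.map (ψ : MvPolynomial (LaurentSeries F) F →+* LaurentSeries F) = C := by
    refine ArithCircuit.map_mapConsts_eq_self _ _ C fun c _ => ?_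
    rw [hψ]; simp
  have hHh : MvPolynomial.map (ψ : MvPolynomial (LaurentSeries F) F →+* LaurentSeries F) Ct.eval = h := by
    rw [← ArithCircuit.eval_map_apply, hback]; exact hCh
  -- every `F`-specialisation of the generic circuit has size `≤ r`
  have hsize : ∀ {B : Type u} [CommSemiring B] (φ : MvPolynomial (LaurentSeries F) F →+* B),
      (Ct.map φ).size ≤ r := by
    intro B _ φ
    rw [ArithCircuit.size_map, ← ArithCircuit.size_map
      (ψ : MvPolynomial (LaurentSeries F) F →+* LaurentSeries F) Ct, hback, hCs]
    exact hr
  have hspec : ∀ a : LaurentSeries F → F,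
      complexity (MvPolynomial.map ((aeval a : MvPolynomial (LaurentSeries F) F →ₐ[F] F) :
        MvPolynomial (LaurentSeries F) F →+* F) Ct.eval) ≤ r := by
    intro a
    rw [← ArithCircuit.eval_map_apply]
    exact (ArithCircuit.complexity_le_size ((hC2.mapConsts _).map _) rfl).trans (hsize _)
  -- the polynomial `Pgen = P(coeff H̃)` in the generic constants vanishes at every `F`-point
  set Pgen : MvPolynomial (LaurentSeries F) F := aeval (fun d => coeff d Ct.eval) P with hPgen
  have hnat : ∀ {B : Type u} [CommRing B] [Algebra F B]
      (θ : MvPolynomial (LaurentSeries F) F →ₐ[F] B),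
      θ Pgen = aeval (fun d => coeff d (MvPolynomial.map (θ : MvPolynomial (LaurentSeries F) F →+* B)
        Ct.eval)) P := by
    intro B _ _ θ
    rw [hPgen, ← AlgHom.comp_apply, MvPolynomial.comp_aeval]
    congr 1
  have hPgen0 : Pgen = 0 := by
    refine MvPolynomial.funext fun a => ?_
    have h1 : eval a Pgen =
        aeval (fun d => coeff d (MvPolynomial.map (eval a) Ct.eval)) P := hnat (aeval a)
    rw [map_zero, h1]
    exact hP (coeffVec (MvPolynomial.map (eval a) Ct.eval)) ⟨_, hspec a, rfl⟩
  -- hence `P(coeff h) = 0` in `K`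
  have hPh : aeval (fun d => coeff d h) P = 0 := by
    have := hnat ψ
    rw [hPgen0, map_zero, hHh] at this
    exact this.symm
  -- and `P(coeff h) = P(coeff f) + O(ε)` since `P` has coefficients in `F`
  have hx : ∀ d, IsOrdGE 0 (coeff d h) := fun d => by
    have : h = (h - MvPolynomial.map (algebraMap F (LaurentSeries F)) f) +
        MvPolynomial.map (algebraMap F (LaurentSeries F)) f := by ring
    rw [this, coeff_add]
    exact ((hh d).mono zero_le_one).add (PolyOrdGE.map_algebraMap f d)
  have hy : ∀ d, IsOrdGE 0 (coeff d (MvPolynomial.map (algebraMap F (LaurentSeries F)) f)) :=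
    fun d => PolyOrdGE.map_algebraMap f d
  have hxy : ∀ d, IsOrdGE 1 (coeff d h - coeff d (MvPolynomial.map (algebraMap F (LaurentSeries F)) f)) :=
    fun d => by rw [← coeff_sub]; exact hh d
  obtain ⟨-, -, hdiff⟩ := isOrdGE_aeval_sub_aeval P hx hy hxy
  rw [hPh, zero_sub] at hdiff
  -- `P(coeff (map f)) = algebraMap (P(coeff f))`, a constant, so it vanishes
  have hconst : aeval (fun d => coeff d (MvPolynomial.map (algebraMap F (LaurentSeries F)) f)) P =
      algebraMap F (LaurentSeries F) (aeval (coeffVec f) P) := by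
    change _ = (Algebra.ofId F (LaurentSeries F)) (aeval (coeffVec f) P)
    rw [← AlgHom.comp_apply, MvPolynomial.comp_aeval]
    congr 1
  rw [hconst, algebraMap_laurentSeries_apply] at hdiff
  have := hdiff.neg
  rw [neg_neg] at this
  have h0 := this 0 zero_lt_one
  rwa [HahnSeries.C_apply, HahnSeries.coeff_single_same] at h0

/-- The same from `borderComplexity f ≤ r`. [cite: Burgisser2004Factors, Thm. 2.2 (easy inclusion)] -/
theorem coeffVec_mem_zariskiClosure_of_borderComplexity_le (f : MvPolynomial σ F) {r : ℕ}
    (hr : borderComplexity f ≤ r) :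
    coeffVec f ∈ zariskiClosure (coeffVec '' {g : MvPolynomial σ F | complexity g ≤ r}) := by
  obtain ⟨h, hc, hh⟩ := exists_polyOrdGE_complexity_le f
  exact coeffVec_mem_zariskiClosure_of_polyOrdGE f h (hc.trans hr) hh

end Generic

/-- **BLMW's `L̲` (Zariski rendering) is at most the `ε`-rendering: `approxComplexity f ≤
borderComplexity f` over `ℂ`** (Bürgisser 2004 Thm. 2.2, easy inclusion; BLMW 2011, remark
after Def. 9.3.1). [cite: Burgisser2004Factors, Thm. 2.2; BurgisserEtAl2011, Def. 9.3.1 (remark following it)] -/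
theorem approxComplexity_le_borderComplexity {σ : Type*} [Fintype σ] [DecidableEq σ]
    (f : MvPolynomial σ ℂ) : approxComplexity f ≤ borderComplexity f :=
  Nat.sInf_le (coeffVec_mem_zariskiClosure_of_borderComplexity_le f le_rfl)

end Literature.Computability.AlgebraicComplexity

end
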